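import Literature.AlgebraicGeometry.Motives.ZetaFunctionOfDiagonalHypersurface
import Literature.AlgebraicGeometry.Motives.PointCountsDetermineBettiNumbers
import HarnessLib

/-!
# The Weil conjectures for the diagonal hypersurface `X = V₊(Σ βᵢ xᵢ^d) ⊂ ℙⁿ⁺¹_{𝔽_q}` (`d ∣ q − 1`, `n ≥ 1`):
# the Weil factorisation of `Z(X, T)`, its uniqueness, the Betti numbers `deg Pᵢ` and the Euler characteristic
# (Weil 1949, p. 507; Ireland–Rosen Ch. 11 §3, (a)–(d))

Topic `Literature/AlgebraicGeometry/Motives`; THEOREMS ONLY (no definition, no instance, no named fact;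
D-0026).  Sequel of `Motives/ZetaFunctionOfDiagonalHypersurface` (g49-#2), which transferred Weil's computation to
the scheme's `Z(X, T) = Motives.zetaSeries X`: `∃ P ∈ ℤ[T]`, `s ⊂ ℂ` with `P = Π_{α∈s}(1 − αT)`, `|α| = q^{n/2}`,
`Z(X,T)·Π_{j≤n}(1 − qʲT) = P^{(−1)^{n+1}}`, `d·#s = (d−1)^{n+2} + (−1)^{n+2}(d−1)`.  Here this is packaged in the
tree's normal form of the Weil conjectures, `Motives.IsWeilFactorization q n Z (Pᵢ)_{i ≤ 2n}` (`Motives/ZetaFunction`: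
`Pᵢ(0) = 1`, `Z·Π_{i even}Pᵢ = Π_{i odd}Pᵢ`, `P₀ = 1 − T`, `P₂ₙ = 1 − qⁿT`, every complex root of `Pᵢ` of absolute
value `q^{−i/2}`), exactly as `Motives/WeilConjecturesForProjectiveSpace` (g48-#2) did for `ℙⁿ`: `P_{2j} = 1 − qʲT`
for `0 ≤ j ≤ n`, all other `Pᵢ = 1`, EXCEPT in the middle degree `i = n`, where the numerator `P` is an extra factor
— Weil's own summary, p. 507: «one finds that the Poincaré polynomial … is equal to `Σ_{j=0}^{r−1} X^{2j} + A·X^{r−1}`»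
(his `r − 1` = `dim X` = our `n`, `A = #s`) and «`Z(U) = P₁(U)P₃(U)⋯P_{2n−1}(U)/(P₀(U)P₂(U)⋯P_{2n}(U))` with
`P₀(U) = 1 − U`, `P_{2n}(U) = 1 − qⁿU`, and, for `1 ≤ h ≤ 2n−1`: `P_h(U) = Π(1 − α_{hi}U)` where the `α_{hi}` are
algebraic integers of absolute value `q^{h/2}`» (held `paper:doi-10-1090-s0002-9904-1949-09219-4` p0011, quoted in
`NumberTheory/GaussSums/FermatHypersurfaceZetaFunctionGeneral`).  The hypothesis `n ≥ 1` is needed: for `n = 0`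
(`d` points in `ℙ¹`) the factor `P₀` is `(1 − T)·P`, not `1 − T` (the variety is not geometrically connected).

## What is here

* §1 (pure algebra, any `q ≥ 1`, `n ≥ 1`, `Z ∈ ℚ⟦T⟧`) **`isWeilFactorization_of_middle_numerator`** — from
  `P ∈ ℤ[T]` with `P = Π_{α∈s}(1 − αT)` over `ℂ`, `|α| = q^{n/2}` on `s`, and the parity identities
  `Z·Π_{j≤n}(1 − qʲT) = P` (`n` odd) ∕ `Z·Π_{j≤n}(1 − qʲT)·P = 1` (`n` even), the family
  `Pᵢ = [i even](1 − q^{i/2}T) · [i = n] P` is a Weil factorisation of `Z` in dimension `n`; private helpers on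
  `Π_{α∈s}(1 − αT)` (constant term `1`, degree `#s`) and on re-indexing `Fin (2n+1)` by parity.
* §2 the diagonal hypersurface (`k = 𝔽_q`, `d ∣ q − 1`, `β : Fin (n+2) → kˣ`, `n ≥ 1`):
  **`exists_isWeilFactorization_diagonalHypersurface`** (the explicit factorisation with Weil's numerator),
  uniqueness and its readings for ANY Weil factorisation `(Pᵢ)` of `Z(X, T)` in dimension `n`:
  **`IsWeilFactorization.eq_of_ne_of_diagonalHypersurface`** (`Pᵢ = [i even](1 − q^{i/2}T)` for `i ≠ n`),
  `IsWeilFactorization.natDegree_eq_of_ne_of_diagonalHypersurface` (`bᵢ = [i even]`, `i ≠ n`),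
  **`IsWeilFactorization.natDegree_middle_of_diagonalHypersurface`** (`d·(b_n − [n even]) = (d−1)^{n+2} + (−1)ⁿ(d−1)`:
  Weil's `A`, Ireland–Rosen's (d)), **`IsWeilFactorization.eulerChar_of_diagonalHypersurface`**
  (`d·Σ(−1)ⁱbᵢ = d(n+1) + (d−1) + (−1)ⁿ(d−1)^{n+2}`, i.e. `χ = n + 2 + ((1−d)^{n+2} − 1)/d`),
  `IsWeilFactorization.eq_dim_of_diagonalHypersurface` (the dimension of a Weil factorisation of `Z(X,T)` is `n`),
  `existsUnique_isWeilFactorization_diagonalHypersurface`; `exists_isWeilFactorization_fermatHypersurface`.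

Not here: Weil's case `q ≢ 1 (d)`; smoothness of `X` and the identification `bᵢ = dim Hⁱ(X)` in a Weil cohomology
(sequels); the functional equation.

## References

* [Weil1949] A. Weil, Bull. AMS 55 (1949) 497–508, p. 507 (the Poincaré polynomial `Σ X^{2j} + A·X^{r−1}`; the shape
  `Z = P₁⋯P_{2n−1}/(P₀P₂⋯P_{2n})`, `|α_{hi}| = q^{h/2}`).
* [IrelandRosen1990] K. Ireland, M. Rosen, GTM 84, 2nd ed. (1990), Ch. 11 §3 Thm. 2, Remark (1), statements (a)–(d)
  p. 167.
* [Hartshorne1977] R. Hartshorne, Algebraic Geometry, App. C §1 (1.1)–(1.4) (`Bᵢ = deg Pᵢ`, `E = Σ(−1)ⁱBᵢ`).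
* [Deligne1974] P. Deligne, La conjecture de Weil. I, Publ. Math. IHÉS 43 (1974), Th. (1.6) (uniqueness of the `Pᵢ`).
* Tree: `Motives/ZetaFunctionOfDiagonalHypersurface` (g49-#2), `Motives/WeilConjecturesForProjectiveSpace` (g48-#2, the
  pattern), `Motives/PointCountsDetermineBettiNumbers` (`eq_of_isWeilFactorization_of_pointCount_eq`),
  `NumberTheory/LFunctions/WeilConjecturesDeligneReductionProofs` (`IsWeilFactorization.unique`).

## Provenance

Lane `lit-hodgefound` (summit `HodgeConjecture`, Track 2 foundations library, Layer B: motives / zeta functions of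
varieties over finite fields), seat `lit-hodgefound-p29` (literature-prover, generation 49, row g49-#3).
-/

universe u

open Polynomial Finset
open Literature.NumberTheory.LFunctions (eq_of_isWeilFactorization_of_pointCount_eq)
open Literature.NumberTheory.LFunctions.WeilFactorization (prod_univ_filter_eq_prod_range_filter)

noncomputable section

namespace Literature.AlgebraicGeometry.Motives

/-! ### §1 A Weil factorisation from a middle numerator -/

section MiddleNumerator

/-- Re-indexing the even degrees `0, 2, …, 2n` of `Fin (2n+1)` by `r ↦ 2r` (private helper, as in
`Motives/WeilConjecturesForProjectiveSpace`). [folklore] -/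
private theorem prod_univ_filter_even_eq_prod_range {M : Type*} [CommMonoid M] (n : ℕ) (g : ℕ → M) :
    ∏ i ∈ (Finset.univ : Finset (Fin (2 * n + 1))) with Even i.val, g i.val =
      ∏ r ∈ Finset.range (n + 1), g (2 * r) := by
  rw [prod_univ_filter_eq_prod_range_filter]
  have hset : (Finset.range (2 * n + 1)).filter Even = (Finset.range (n + 1)).image (2 * ·) := by
    ext i
    simp only [Finset.mem_filter, Finset.mem_range, Finset.mem_image]
    constructor
    · rintro ⟨hi, ⟨r, hr⟩⟩
      exact ⟨r, by omega, by omega⟩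
    · rintro ⟨r, hr, rfl⟩
      exact ⟨by omega, even_two_mul r⟩
  rw [hset, Finset.prod_image fun a _ b _ h => by simpa using h]

/-- A product over the indices of a given parity of a family supported at the single index `n` (private helper).
[folklore] -/
private theorem prod_univ_filter_ite_val_eq {M : Type*} [CommMonoid M] {m n : ℕ} (hn : n < m) (p : ℕ → Prop)
    [DecidablePred p] (a : M) :
    ∏ i ∈ (Finset.univ : Finset (Fin m)) with p i.val, (if i.val = n then a else 1) = if p n then a else 1 := by
  rw [prod_univ_filter_eq_prod_range_filter m p (fun i => if i = n then a else 1), Finset.prod_ite_eq']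
  by_cases hp : p n
  · rw [if_pos (Finset.mem_filter.mpr ⟨Finset.mem_range.mpr hn, hp⟩), if_pos hp]
  · rw [if_neg (fun h => hp (Finset.mem_filter.mp h).2), if_neg hp]

/-- `1 − qʳT ∈ ℤ[T]` base-changed along a ring map: `1 − qʳT` (private helper). [folklore] -/
private theorem map_one_sub_C_pow_mul_X {R : Type*} [CommRing R] (f : ℤ →+* R) (q r : ℕ) :
    ((1 - C ((q : ℤ) ^ r) * X : ℤ[X]).map f) = 1 - C ((q : R) ^ r) * X := by
  rw [Polynomial.map_sub, Polynomial.map_one, Polynomial.map_mul, Polynomial.map_C, Polynomial.map_X,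
    map_pow, map_natCast]

/-- The constant term of `Π_{α∈s}(1 − αT)` is `1` (private helper). [folklore] -/
private theorem coeff_zero_multiset_prod_one_sub_C_mul_X {R : Type*} [CommRing R] (s : Multiset R) :
    (s.map fun α => (1 - C α * X : R[X])).prod.coeff 0 = 1 := by
  rw [coeff_zero_multiset_prod, Multiset.map_map]
  refine Multiset.prod_eq_one fun x hx => ?_
  obtain ⟨α, -, rfl⟩ := Multiset.mem_map.mp hx
  simp

/-- An integer polynomial which becomes `Π_{α∈s}(1 − αT)` over `ℂ` has constant term `1` (private helper).
[folklore] -/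
private theorem coeff_zero_eq_one_of_map_eq_prod {P : ℤ[X]} {s : Multiset ℂ}
    (hmap : P.map (Int.castRingHom ℂ) = (s.map fun α => 1 - C α * X).prod) : P.coeff 0 = 1 := by
  have h := congrArg (fun p : ℂ[X] => p.coeff 0) hmap
  simp only [Polynomial.coeff_map, eq_intCast, coeff_zero_multiset_prod_one_sub_C_mul_X] at h
  exact_mod_cast h

/-- An integer polynomial which becomes `Π_{α∈s}(1 − αT)` over `ℂ` with all `α ≠ 0` has degree `#s` (private
helper). [folklore] -/
private theorem natDegree_eq_card_of_map_eq_prod {P : ℤ[X]} {s : Multiset ℂ}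
    (hmap : P.map (Int.castRingHom ℂ) = (s.map fun α => 1 - C α * X).prod) (h0 : ∀ α ∈ s, α ≠ 0) :
    P.natDegree = Multiset.card s := by
  rw [← Polynomial.natDegree_map_eq_of_injective (Int.castRingHom ℂ).injective_int P, hmap,
    natDegree_multiset_prod _ (fun hmem => ?_)]
  · rw [Multiset.map_map]
    have h1 : (s.map (natDegree ∘ fun α => (1 - C α * X : ℂ[X]))) = s.map (Function.const ℂ 1) := by
      refine Multiset.map_congr rfl fun α hα => ?_
      rw [Function.comp_apply, Function.const_apply, sub_eq_add_neg, ← neg_mul, ← C_neg, add_comm, ← C_1]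
      exact natDegree_linear (neg_ne_zero.mpr (h0 α hα))
    rw [h1, Multiset.map_const, Multiset.sum_replicate, smul_eq_mul, mul_one]
  · obtain ⟨α, -, hα⟩ := Multiset.mem_map.mp hmem
    have := congrArg (fun p : ℂ[X] => p.coeff 0) hα
    simp at this

/-- **A Weil factorisation from a middle numerator.**  Let `q, n ≥ 1`, `Z ∈ ℚ⟦T⟧`, `P ∈ ℤ[T]` with
`P = Π_{α∈s}(1 − αT)` over `ℂ` for a multiset `s` with `|α| = q^{n/2}` for all `α ∈ s`, and suppose
`Z · Π_{j=0}^{n}(1 − qʲT) = P` if `n` is odd, `Z · Π_{j=0}^{n}(1 − qʲT) · P = 1` if `n` is even (Weil p. 507: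
«`Z(U) = P₁(U)P₃(U)⋯P_{2n−1}(U)/(P₀(U)P₂(U)⋯P_{2n}(U))`», the Poincaré polynomial `Σ_{j} X^{2j} + A·Xⁿ`).  Then
`Pᵢ = [i even]·(1 − q^{i/2}T) · [i = n]·P` (`0 ≤ i ≤ 2n`) is a Weil factorisation of `Z` in dimension `n` in the sense
of `Motives.IsWeilFactorization`: `Pᵢ(0) = 1`, `Z·Π_{i even}Pᵢ = Π_{i odd}Pᵢ`, `P₀ = 1 − T`, `P₂ₙ = 1 − qⁿT`, and the
complex roots of `Pᵢ` have absolute value `q^{−i/2}` (for `i = 2j` the root `q^{−j}`; for `i = n` also the `1/α`).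
[cite: Weil1949, p. 507] [cite: Hartshorne1977, App. C §1 (1.1)–(1.3)] -/
theorem isWeilFactorization_of_middle_numerator {q n : ℕ} (hq : 0 < q) (hn : 0 < n) {Z : PowerSeries ℚ}
    {P : ℤ[X]} {s : Multiset ℂ} (hmap : P.map (Int.castRingHom ℂ) = (s.map fun α => 1 - C α * X).prod)
    (hnorm : ∀ α ∈ s, ‖α‖ = Real.sqrt q ^ n)
    (hodd : Odd n → Z * ((∏ j ∈ Finset.range (n + 1), (1 - C ((q : ℚ) ^ j) * X) : ℚ[X]) : PowerSeries ℚ) =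
      (P.map (Int.castRingHom ℚ) : ℚ[X]))
    (heven : Even n → Z * ((∏ j ∈ Finset.range (n + 1), (1 - C ((q : ℚ) ^ j) * X) : ℚ[X]) : PowerSeries ℚ) *
      (P.map (Int.castRingHom ℚ) : ℚ[X]) = 1) :
    IsWeilFactorization q n Z (fun i : Fin (2 * n + 1) =>
      (if Even (i : ℕ) then 1 - C ((q : ℤ) ^ ((i : ℕ) / 2)) * X else 1) * (if (i : ℕ) = n then P else 1)) := by
  have hqR : (0 : ℝ) ≤ (q : ℝ) := Nat.cast_nonneg _
  have hα0 : ∀ α ∈ s, α ≠ 0 := fun α hα h0 => by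
    have h := hnorm α hα
    rw [h0, norm_zero] at h
    have : (0 : ℝ) < Real.sqrt q ^ n := pow_pos (Real.sqrt_pos.mpr (by exact_mod_cast hq)) n
    linarith
  have hP0 : P.coeff 0 = 1 := coeff_zero_eq_one_of_map_eq_prod hmap
  refine ⟨fun i => ?_, ?_, ?_, ?_, fun i z hz => ?_⟩
  · -- constant terms
    dsimp only
    rw [mul_coeff_zero]
    split_ifs <;> simp [hP0]
  · -- rationality `Z · Π_{even} Pᵢ = Π_{odd} Pᵢ`
    have hevenprod : ∏ i ∈ (Finset.univ : Finset (Fin (2 * n + 1))) with Even i.val,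
        ((((if Even (i : ℕ) then 1 - C ((q : ℤ) ^ ((i : ℕ) / 2)) * X else (1 : ℤ[X])) *
            (if (i : ℕ) = n then P else 1)).map (Int.castRingHom ℚ) : ℚ[X]) : PowerSeries ℚ) =
        ((∏ j ∈ Finset.range (n + 1), (1 - C ((q : ℚ) ^ j) * X) : ℚ[X]) : PowerSeries ℚ) *
          (if Even n then ((P.map (Int.castRingHom ℚ) : ℚ[X]) : PowerSeries ℚ) else 1) := by
      have hsplit : ∀ i : Fin (2 * n + 1),
          ((((if Even (i : ℕ) then 1 - C ((q : ℤ) ^ ((i : ℕ) / 2)) * X else (1 : ℤ[X])) *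
              (if (i : ℕ) = n then P else 1)).map (Int.castRingHom ℚ) : ℚ[X]) : PowerSeries ℚ) =
            (((if Even (i : ℕ) then 1 - C ((q : ℤ) ^ ((i : ℕ) / 2)) * X else (1 : ℤ[X])).map
                (Int.castRingHom ℚ) : ℚ[X]) : PowerSeries ℚ) *
              (if (i : ℕ) = n then ((P.map (Int.castRingHom ℚ) : ℚ[X]) : PowerSeries ℚ) else 1) := fun i => by
        rw [Polynomial.map_mul, Polynomial.coe_mul]
        congr 1
        split_ifs
        · rfl
        · rw [Polynomial.map_one, Polynomial.coe_one]
      rw [Finset.prod_congr rfl fun i _ => hsplit i, Finset.prod_mul_distrib,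
        prod_univ_filter_ite_val_eq (show n < 2 * n + 1 by omega),
        prod_univ_filter_even_eq_prod_range n (fun i => (((if Even i then
          1 - C ((q : ℤ) ^ (i / 2)) * X else (1 : ℤ[X])).map (Int.castRingHom ℚ) : ℚ[X]) : PowerSeries ℚ)),
        ← Polynomial.coeToPowerSeries.ringHom_apply (φ := ∏ j ∈ Finset.range (n + 1), (1 - C ((q : ℚ) ^ j) * X)),
        map_prod]
      congr 1
      refine Finset.prod_congr rfl fun r _ => ?_
      rw [if_pos (even_two_mul r), Nat.mul_div_cancel_left r two_pos, map_one_sub_C_pow_mul_X,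
        Polynomial.coeToPowerSeries.ringHom_apply]
    have hoddprod : ∏ i ∈ (Finset.univ : Finset (Fin (2 * n + 1))) with Odd i.val,
        ((((if Even (i : ℕ) then 1 - C ((q : ℤ) ^ ((i : ℕ) / 2)) * X else (1 : ℤ[X])) *
            (if (i : ℕ) = n then P else 1)).map (Int.castRingHom ℚ) : ℚ[X]) : PowerSeries ℚ) =
        (if Odd n then ((P.map (Int.castRingHom ℚ) : ℚ[X]) : PowerSeries ℚ) else 1) := by
      rw [← prod_univ_filter_ite_val_eq (show n < 2 * n + 1 by omega) Odd
        ((P.map (Int.castRingHom ℚ) : ℚ[X]) : PowerSeries ℚ)]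
      refine Finset.prod_congr rfl fun i hi => ?_
      rw [if_neg (Nat.not_even_iff_odd.mpr (Finset.mem_filter.mp hi).2), one_mul]
      split_ifs
      · rfl
      · rw [Polynomial.map_one, Polynomial.coe_one]
    rw [hevenprod, hoddprod]
    rcases Nat.even_or_odd n with he | ho
    · rw [if_pos he, if_neg (Nat.not_odd_iff_even.mpr he), ← mul_assoc]
      exact heven he
    · rw [if_neg (Nat.not_even_iff_odd.mpr ho), if_pos ho, mul_one]
      exact hodd ho
  · -- `P₀ = 1 − T`
    dsimp only
    rw [if_pos (show Even ((0 : Fin (2 * n + 1)) : ℕ) from ⟨0, rfl⟩),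
      if_neg (show ((0 : Fin (2 * n + 1)) : ℕ) ≠ n by rw [Fin.val_zero]; omega), mul_one, Fin.val_zero,
      Nat.zero_div, pow_zero, C_1, one_mul]
  · -- `P₂ₙ = 1 − qⁿT`
    dsimp only
    rw [Fin.val_last, if_pos (even_two_mul n), if_neg (show 2 * n ≠ n by omega), mul_one,
      Nat.mul_div_cancel_left n two_pos]
  · -- the Riemann hypothesis
    dsimp only at hz
    rw [Polynomial.map_mul, root_mul] at hz
    rcases hz with hz | hz
    · split_ifs at hz with hi
      · obtain ⟨r, hr⟩ := hi
        have hir : (i : ℕ) / 2 = r := by omega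
        rw [hir, map_one_sub_C_pow_mul_X, IsRoot.def, eval_sub, eval_one, eval_mul, eval_C, eval_X,
          sub_eq_zero] at hz
        have hzval : z = ((q : ℂ) ^ r)⁻¹ := eq_inv_of_mul_eq_one_right hz.symm
        rw [hzval, norm_inv, norm_pow, Complex.norm_natCast, hr, ← Real.rpow_natCast, ← Real.rpow_neg hqR]
        congr 1
        push_cast
        ring
      · rw [Polynomial.map_one] at hz
        exact absurd hz (by simp)
    · split_ifs at hz with hi
      · rw [hmap, IsRoot.def, eval_multiset_prod, Multiset.map_map, Multiset.prod_eq_zero_iff,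
          Multiset.mem_map] at hz
        obtain ⟨α, hα, h0⟩ := hz
        simp only [Function.comp_apply, eval_sub, eval_one, eval_mul, eval_C, eval_X] at h0
        rw [sub_eq_zero] at h0
        have hzval : z = α⁻¹ := eq_inv_of_mul_eq_one_right h0.symm
        rw [hzval, norm_inv, hnorm α hα, hi, Real.sqrt_eq_rpow, ← Real.rpow_mul_natCast hqR,
          ← Real.rpow_neg hqR]
        congr 1
        ring
      · rw [Polynomial.map_one] at hz
        exact absurd hz (by simp)

/-- The degree of the middle member `P_n = [n even](1 − q^{n/2}T) · P` of the factorisation of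
`isWeilFactorization_of_middle_numerator`: `deg P_n = [n even] + #s` (private helper). [folklore] -/
private theorem natDegree_middle_of_map_eq_prod {q n : ℕ} (hq : 0 < q) {P : ℤ[X]} {s : Multiset ℂ}
    (hmap : P.map (Int.castRingHom ℂ) = (s.map fun α => 1 - C α * X).prod) (h0 : ∀ α ∈ s, α ≠ 0) :
    ((if Even n then 1 - C ((q : ℤ) ^ (n / 2)) * X else (1 : ℤ[X])) * (if n = n then P else 1)).natDegree =
      (if Even n then 1 else 0) + Multiset.card s := by
  have hP : P ≠ 0 := fun h => by
    have := coeff_zero_eq_one_of_map_eq_prod hmap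
    rw [h, coeff_zero] at this
    exact zero_ne_one this
  rw [if_pos rfl]
  split_ifs with he
  · have hq' : -((q : ℤ) ^ (n / 2)) ≠ 0 := neg_ne_zero.mpr (pow_ne_zero _ (by exact_mod_cast hq.ne'))
    have hlin : (1 - C ((q : ℤ) ^ (n / 2)) * X : ℤ[X]).natDegree = 1 := by
      rw [sub_eq_add_neg, ← neg_mul, ← C_neg, add_comm, ← C_1]
      exact natDegree_linear hq'
    have hne : (1 - C ((q : ℤ) ^ (n / 2)) * X : ℤ[X]) ≠ 0 := fun h => by rw [h, natDegree_zero] at hlin; exact zero_ne_one hlin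
    rw [natDegree_mul hne hP, hlin, natDegree_eq_card_of_map_eq_prod hmap h0]
  · rw [one_mul, natDegree_eq_card_of_map_eq_prod hmap h0, zero_add]

end MiddleNumerator

/-! ### §2 The diagonal hypersurface `X = V₊(Σ βᵢ xᵢ^d)`, `d ∣ q − 1`, `n ≥ 1` -/

section Diagonal

open SmoothHypersurface

variable {k : Type u} [Field k] [Finite k] {n : ℕ}

/-- **The Weil conjectures for the diagonal hypersurface `X = V₊(Σ βᵢxᵢ^d) ⊂ ℙⁿ⁺¹_{𝔽_q}` (`d ∣ q − 1`, `n ≥ 1`),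
as a `Motives.IsWeilFactorization` of `Z(X, T) = Motives.zetaSeries X` in dimension `n`** (Weil 1949 p. 507;
Ireland–Rosen (a)–(d) p. 167): there are `P ∈ ℤ[T]` and `s ⊂ ℂ` with `P = Π_{α∈s}(1 − αT)`, `|α| = q^{n/2}` and
`qⁿ/α ∈ s` for `α ∈ s`, `d·#s = (d−1)^{n+2} + (−1)^{n+2}(d−1)`, such that `Pᵢ = [i even](1 − q^{i/2}T)·[i = n]P`
(`0 ≤ i ≤ 2n`) is a Weil factorisation of `Z(X, T)`: `Z(X,T) = P₁⋯P_{2n−1}/(P₀P₂⋯P_{2n})`, `P₀ = 1 − T`,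
`P_{2n} = 1 − qⁿT`, Riemann hypothesis `|roots of Pᵢ| = q^{−i/2}`.
[cite: Weil1949, p. 507] [cite: IrelandRosen1990, Ch. 11 §3, Thm. 2 and statements (a)–(d) p. 167] -/
theorem exists_isWeilFactorization_diagonalHypersurface (hn : 0 < n) {d : ℕ} (hd : d ∣ Nat.card k - 1)
    (β : Fin (n + 2) → kˣ) :
    ∃ (P : ℤ[X]) (s : Multiset ℂ),
      P.map (Int.castRingHom ℂ) = (s.map fun α => 1 - C α * X).prod ∧
      (∀ α ∈ s, ‖α‖ = Real.sqrt (Nat.card k) ^ n ∧ (Nat.card k : ℂ) ^ n / α ∈ s) ∧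
      (d : ℤ) * Multiset.card s = ((d : ℤ) - 1) ^ (n + 2) + (-1) ^ (n + 2) * ((d : ℤ) - 1) ∧
      IsWeilFactorization (Nat.card k) n
        (zetaSeries (hypersurface (∑ i, MvPolynomial.C (β i : k) * MvPolynomial.X i ^ d :
          MvPolynomial (Fin (n + 2)) k)))
        (fun i : Fin (2 * n + 1) => (if Even (i : ℕ) then 1 - C ((Nat.card k : ℤ) ^ ((i : ℕ) / 2)) * X else 1) *
          (if (i : ℕ) = n then P else 1)) := by
  obtain ⟨P, s, h1, h2, h3, h4, h5⟩ := weil1949_zetaSeries_diagonalHypersurface (n := n) hd β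
  rw [algebraMap_int_eq] at h1
  exact ⟨P, s, h1, h2, h5,
    isWeilFactorization_of_middle_numerator Nat.card_pos hn h1 (fun α hα => (h2 α hα).1) h3 h4⟩

/-- `Z(X, T)` of the diagonal hypersurface admits a Weil factorisation in dimension `n = dim X` (`n ≥ 1`,
`d ∣ q − 1`). [cite: Weil1949, p. 507] [cite: IrelandRosen1990, Ch. 11 §3, Thm. 2] -/
theorem exists_isWeilFactorization_diagonalHypersurface' (hn : 0 < n) {d : ℕ} (hd : d ∣ Nat.card k - 1)
    (β : Fin (n + 2) → kˣ) :
    ∃ P : Fin (2 * n + 1) → ℤ[X], IsWeilFactorization (Nat.card k) n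
      (zetaSeries (hypersurface (∑ i, MvPolynomial.C (β i : k) * MvPolynomial.X i ^ d :
        MvPolynomial (Fin (n + 2)) k))) P := by
  obtain ⟨P, s, -, -, -, hW⟩ := exists_isWeilFactorization_diagonalHypersurface hn hd β
  exact ⟨_, hW⟩

/-- **Off the middle degree the Weil factorisation of `Z(X, T)` is that of `ℙⁿ⁺¹`**: for ANY Weil factorisation
`(Pᵢ)_{i ≤ 2n}` of `Z(X, T)` in dimension `n` and `i ≠ n`, `Pᵢ = 1 − q^{i/2}T` if `i` is even and `Pᵢ = 1` if `i`
is odd (uniqueness of Weil factorisations, Deligne Th. (1.6) ∕ the tree's `IsWeilFactorization.unique`; Weil's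
Poincaré polynomial `Σⱼ X^{2j} + A·Xⁿ`). [cite: Weil1949, p. 507] [cite: Deligne1974, Th. (1.6) and p. 277] -/
theorem IsWeilFactorization.eq_of_ne_of_diagonalHypersurface {d : ℕ} {β : Fin (n + 2) → kˣ}
    {P : Fin (2 * n + 1) → ℤ[X]}
    (hW : IsWeilFactorization (Nat.card k) n
      (zetaSeries (hypersurface (∑ i, MvPolynomial.C (β i : k) * MvPolynomial.X i ^ d :
        MvPolynomial (Fin (n + 2)) k))) P)
    (hn : 0 < n) (hd : d ∣ Nat.card k - 1) {i : Fin (2 * n + 1)} (hi : (i : ℕ) ≠ n) :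
    P i = if Even (i : ℕ) then 1 - C ((Nat.card k : ℤ) ^ ((i : ℕ) / 2)) * X else 1 := by
  obtain ⟨P₀, s, -, -, -, hW₀⟩ := exists_isWeilFactorization_diagonalHypersurface hn hd β
  rw [hW.unique Finite.one_lt_card hW₀]
  dsimp only
  rw [if_neg hi, mul_one]

/-- **The Betti numbers off the middle degree**: `deg Pᵢ = [i even]` for `i ≠ n`, for any Weil factorisation of
`Z(X, T)` in dimension `n` (Hartshorne (1.4) «the degree of `Pᵢ(t)` is the `i`th Betti number»; Weil's
`B_{2j} = 1`, `B_{odd ≠ n} = 0`). [cite: Weil1949, p. 507] [cite: Hartshorne1977, App. C §1 (1.4)] -/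
theorem IsWeilFactorization.natDegree_eq_of_ne_of_diagonalHypersurface {d : ℕ} {β : Fin (n + 2) → kˣ}
    {P : Fin (2 * n + 1) → ℤ[X]}
    (hW : IsWeilFactorization (Nat.card k) n
      (zetaSeries (hypersurface (∑ i, MvPolynomial.C (β i : k) * MvPolynomial.X i ^ d :
        MvPolynomial (Fin (n + 2)) k))) P)
    (hn : 0 < n) (hd : d ∣ Nat.card k - 1) {i : Fin (2 * n + 1)} (hi : (i : ℕ) ≠ n) :
    (P i).natDegree = if Even (i : ℕ) then 1 else 0 := by
  rw [hW.eq_of_ne_of_diagonalHypersurface hn hd hi]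
  split_ifs with he
  · have hq : -((Nat.card k : ℤ) ^ ((i : ℕ) / 2)) ≠ 0 :=
      neg_ne_zero.mpr (pow_ne_zero _ (by exact_mod_cast Nat.card_pos.ne'))
    rw [sub_eq_add_neg, ← neg_mul, ← C_neg, add_comm, ← C_1]
    exact natDegree_linear hq
  · rw [natDegree_one]

/-- **The middle Betti number** (Weil's `A`, Ireland–Rosen's Remark (1) ∕ (d) «The degree of `P(t)` is
`d⁻¹[(d−1)^{n+1} + (−1)^{n+1}(d−1)]`», their `n + 1` variables = our `n + 2`): for any Weil factorisation of `Z(X, T)`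
in dimension `n`, `d · (deg P_n − [n even]) = (d − 1)^{n+2} + (−1)^{n+2}(d − 1)` — `deg P_n` is `[n even]` (the power
of the hyperplane class) plus the number of Weil's reciprocal roots `α`.
[cite: Weil1949, p. 507] [cite: IrelandRosen1990, Ch. 11 §3, Remark (1) and statement (d) p. 167] -/
theorem IsWeilFactorization.natDegree_middle_of_diagonalHypersurface {d : ℕ} {β : Fin (n + 2) → kˣ}
    {P : Fin (2 * n + 1) → ℤ[X]}
    (hW : IsWeilFactorization (Nat.card k) n
      (zetaSeries (hypersurface (∑ i, MvPolynomial.C (β i : k) * MvPolynomial.X i ^ d :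
        MvPolynomial (Fin (n + 2)) k))) P)
    (hn : 0 < n) (hd : d ∣ Nat.card k - 1) :
    (d : ℤ) * (((P ⟨n, by omega⟩).natDegree : ℤ) - if Even n then 1 else 0) =
      ((d : ℤ) - 1) ^ (n + 2) + (-1) ^ (n + 2) * ((d : ℤ) - 1) := by
  obtain ⟨P₀, s, hmap, hns, hcard, hW₀⟩ := exists_isWeilFactorization_diagonalHypersurface hn hd β
  have hα0 : ∀ α ∈ s, α ≠ 0 := fun α hα h0 => by
    have h := (hns α hα).1
    rw [h0, norm_zero] at h
    have : (0 : ℝ) < Real.sqrt (Nat.card k) ^ n :=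
      pow_pos (Real.sqrt_pos.mpr (by exact_mod_cast Nat.card_pos (α := k))) n
    linarith
  rw [hW.unique Finite.one_lt_card hW₀]
  dsimp only
  rw [natDegree_middle_of_map_eq_prod Nat.card_pos hmap hα0, ← hcard]
  push_cast
  split_ifs <;> ring

/-- **The Euler characteristic of the diagonal hypersurface**: for any Weil factorisation of `Z(X, T)` in dimension
`n`, `E = Σ_{i=0}^{2n} (−1)ⁱ deg Pᵢ` (Hartshorne (1.4), the self-intersection of the diagonal in (1.2)) satisfies
`d·E = d(n + 1) + (d − 1) + (−1)ⁿ(d − 1)^{n+2}`, i.e. `E = n + 2 + ((1 − d)^{n+2} − 1)/d`: Weil's Poincaré polynomial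
`Σ_{j=0}^{n} X^{2j} + A·Xⁿ` evaluated at `X = −1`, with `d·A = (d−1)^{n+2} + (−1)ⁿ(d−1)`.
[cite: Weil1949, p. 507] [cite: Hartshorne1977, App. C §1 (1.2) and (1.4)] [cite: IrelandRosen1990, Ch. 11 §3, Remark (1)] -/
theorem IsWeilFactorization.eulerChar_of_diagonalHypersurface {d : ℕ} {β : Fin (n + 2) → kˣ}
    {P : Fin (2 * n + 1) → ℤ[X]}
    (hW : IsWeilFactorization (Nat.card k) n
      (zetaSeries (hypersurface (∑ i, MvPolynomial.C (β i : k) * MvPolynomial.X i ^ d :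
        MvPolynomial (Fin (n + 2)) k))) P)
    (hn : 0 < n) (hd : d ∣ Nat.card k - 1) :
    (d : ℤ) * ∑ i : Fin (2 * n + 1), (-1 : ℤ) ^ (i : ℕ) * ((P i).natDegree : ℤ) =
      d * (n + 1) + ((d : ℤ) - 1) + (-1) ^ n * ((d : ℤ) - 1) ^ (n + 2) := by
  -- split off the middle index
  have hmid : (⟨n, by omega⟩ : Fin (2 * n + 1)) ∈ (Finset.univ : Finset (Fin (2 * n + 1))) := Finset.mem_univ _
  rw [← Finset.add_sum_erase _ _ hmid]
  -- the other indices are those of `ℙⁿ⁺¹` minus the middle one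
  have hrest : ∑ i ∈ (Finset.univ : Finset (Fin (2 * n + 1))).erase ⟨n, by omega⟩,
      (-1 : ℤ) ^ (i : ℕ) * ((P i).natDegree : ℤ) =
        ∑ i ∈ (Finset.univ : Finset (Fin (2 * n + 1))).erase ⟨n, by omega⟩,
          (if Even (i : ℕ) then (1 : ℤ) else 0) := by
    refine Finset.sum_congr rfl fun i hi => ?_
    have hi' : (i : ℕ) ≠ n := fun h => (Finset.mem_erase.mp hi).1 (Fin.ext h)
    rw [hW.natDegree_eq_of_ne_of_diagonalHypersurface hn hd hi']
    split_ifs with he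
    · rw [he.neg_one_pow, Nat.cast_one, mul_one]
    · rw [Nat.cast_zero, mul_zero]
  have hfull : ∑ i : Fin (2 * n + 1), (if Even (i : ℕ) then (1 : ℤ) else 0) = n + 1 := by
    rw [Fin.sum_univ_eq_sum_range (fun i => if Even i then (1 : ℤ) else 0) (2 * n + 1), ← Finset.sum_filter,
      Finset.sum_const, nsmul_eq_mul, mul_one]
    have hset : (Finset.range (2 * n + 1)).filter Even = (Finset.range (n + 1)).image (2 * ·) := by
      ext i
      simp only [Finset.mem_filter, Finset.mem_range, Finset.mem_image]
      constructor
      · rintro ⟨hi, ⟨r, hr⟩⟩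
        exact ⟨r, by omega, by omega⟩
      · rintro ⟨r, hr, rfl⟩
        exact ⟨by omega, even_two_mul r⟩
    rw [hset, Finset.card_image_of_injective _ fun a b h => by simpa using h, Finset.card_range]
    push_cast
    ring
  have hrest' : ∑ i ∈ (Finset.univ : Finset (Fin (2 * n + 1))).erase ⟨n, by omega⟩,
      (if Even (i : ℕ) then (1 : ℤ) else 0) = n + 1 - (if Even n then 1 else 0) := by
    rw [← hfull, ← Finset.add_sum_erase _ _ hmid]
    ring
  have hmiddle := hW.natDegree_middle_of_diagonalHypersurface hn hd
  rw [hrest, hrest']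
  rcases Nat.even_or_odd n with he | ho
  · rw [if_pos he] at hmiddle ⊢
    rw [he.neg_one_pow]
    have h2 : (-1 : ℤ) ^ (n + 2) = 1 := by rw [pow_add, he.neg_one_pow]; norm_num
    rw [h2] at hmiddle
    linear_combination hmiddle
  · rw [if_neg (Nat.not_even_iff_odd.mpr ho)] at hmiddle ⊢
    rw [ho.neg_one_pow]
    have h2 : (-1 : ℤ) ^ (n + 2) = -1 := by rw [pow_add, ho.neg_one_pow]; norm_num
    rw [h2] at hmiddle
    linear_combination -hmiddle

/-- **The dimension is forced**: a Weil factorisation of `Z(X, T)` in dimension `m` has `m = n = dim X` (the point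
counts grow like `q^{nm}` — Lang–Weil; the tree's `eq_of_isWeilFactorization_of_pointCount_eq`).
[cite: LangWeil1954, Th. 1] [cite: Weil1949, p. 507] -/
theorem IsWeilFactorization.eq_dim_of_diagonalHypersurface {d m : ℕ} {β : Fin (n + 2) → kˣ}
    {P : Fin (2 * m + 1) → ℤ[X]}
    (hW : IsWeilFactorization (Nat.card k) m
      (zetaSeries (hypersurface (∑ i, MvPolynomial.C (β i : k) * MvPolynomial.X i ^ d :
        MvPolynomial (Fin (n + 2)) k))) P)
    (hn : 0 < n) (hd : d ∣ Nat.card k - 1) : m = n := by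
  obtain ⟨P₀, hW₀⟩ := exists_isWeilFactorization_diagonalHypersurface' hn hd β
  exact eq_of_isWeilFactorization_of_pointCount_eq hW hW₀ fun _ _ => rfl

/-- `Z(X, T)` has a Weil factorisation in dimension `m` if and only if `m = n` (`n ≥ 1`, `d ∣ q − 1`).
[cite: Weil1949, p. 507] [cite: LangWeil1954, Th. 1] -/
theorem exists_isWeilFactorization_diagonalHypersurface_iff (hn : 0 < n) {d : ℕ} (hd : d ∣ Nat.card k - 1)
    (β : Fin (n + 2) → kˣ) {m : ℕ} :
    (∃ P : Fin (2 * m + 1) → ℤ[X], IsWeilFactorization (Nat.card k) m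
      (zetaSeries (hypersurface (∑ i, MvPolynomial.C (β i : k) * MvPolynomial.X i ^ d :
        MvPolynomial (Fin (n + 2)) k))) P) ↔ m = n := by
  constructor
  · rintro ⟨P, hW⟩
    exact hW.eq_dim_of_diagonalHypersurface hn hd
  · rintro rfl
    exact exists_isWeilFactorization_diagonalHypersurface' hn hd β

/-- **Uniqueness**: `Z(X, T)` has EXACTLY ONE Weil factorisation in dimension `n` (Deligne Th. (1.6): the `Pᵢ`
are determined by `Z`). [cite: Deligne1974, Th. (1.6) and p. 277] [cite: Weil1949, p. 507] -/
theorem existsUnique_isWeilFactorization_diagonalHypersurface (hn : 0 < n) {d : ℕ} (hd : d ∣ Nat.card k - 1)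
    (β : Fin (n + 2) → kˣ) :
    ∃! P : Fin (2 * n + 1) → ℤ[X], IsWeilFactorization (Nat.card k) n
      (zetaSeries (hypersurface (∑ i, MvPolynomial.C (β i : k) * MvPolynomial.X i ^ d :
        MvPolynomial (Fin (n + 2)) k))) P := by
  obtain ⟨P, hW⟩ := exists_isWeilFactorization_diagonalHypersurface' hn hd β
  exact ⟨P, hW, fun P' hW' => hW'.unique Finite.one_lt_card hW⟩

/-- **The Weil conjectures for the Fermat hypersurface `V = V₊(x₀^d + ⋯ + x_{n+1}^d)`** (`n ≥ 1`, `d ∣ q − 1`): the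
explicit Weil factorisation of `Z(V, T)` with middle numerator `P = Π_{α∈s}(1 − αT)`, `|α| = q^{n/2}` (the `α` being
Deligne's Jacobi sums `J(ε^a)`, Prop. 7.10), `d·#s = (d−1)^{n+2} + (−1)^{n+2}(d−1)`.
[cite: Weil1949, p. 507] [cite: Deligne1982HodgeCycles, §7, Prop. 7.10] [cite: IrelandRosen1990, Ch. 11 §3, Thm. 2] -/
theorem exists_isWeilFactorization_fermatHypersurface (hn : 0 < n) {d : ℕ} (hd : d ∣ Nat.card k - 1) :
    ∃ (P : ℤ[X]) (s : Multiset ℂ),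
      P.map (Int.castRingHom ℂ) = (s.map fun α => 1 - C α * X).prod ∧
      (∀ α ∈ s, ‖α‖ = Real.sqrt (Nat.card k) ^ n ∧ (Nat.card k : ℂ) ^ n / α ∈ s) ∧
      (d : ℤ) * Multiset.card s = ((d : ℤ) - 1) ^ (n + 2) + (-1) ^ (n + 2) * ((d : ℤ) - 1) ∧
      IsWeilFactorization (Nat.card k) n (zetaSeries (hypersurface (fermatPolynomial k n d)))
        (fun i : Fin (2 * n + 1) => (if Even (i : ℕ) then 1 - C ((Nat.card k : ℤ) ^ ((i : ℕ) / 2)) * X else 1) *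
          (if (i : ℕ) = n then P else 1)) := by
  rw [← sum_C_one_mul_X_pow_eq_fermatPolynomial]
  exact exists_isWeilFactorization_diagonalHypersurface hn hd fun _ => 1

end Diagonal

end Literature.AlgebraicGeometry.Motives
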